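import Literature.AlgebraicGeometry.Motives.HodgeLieSymplecticBlocksSemisimple
import HarnessLib

/-!
# `Lie Hg ⊗ ℂ = ⊕_i 𝔰𝔭(T_i)` over the four-dimensional real eigenblocks of the Hodge endomorphisms: the Goursat step for rigid
# symplectic factors (Moonen–Zarhin 1995 Type I(2), `Hg = R_{F/ℚ} Sp_{4,F}`; 1999 §3 (3.1), Lemma (3.4))

Family `hodge`, layer `Literature/AlgebraicGeometry/Motives` (abstract polarizable `ℚ`-Hodge structures; no geometry); THEOREMS ONLY (no
definition, no named fact; D-0026).  Research context: cell `pub-hodgecm2` (COR-CM), seat `b27`, count-neutral lane MT-RANK ladder, rung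
`t = 10e + 1` (real multiplication of relative dimension two).  UNCONDITIONAL; nothing here uses or asserts HC_CM.  Sequel of
`HodgeLieSymplecticBlocksRankFour` (S1: `Lie Hg ⊗ ℂ` restricts ONTO `𝔰𝔭(T_i)` on every block), `SymplecticRankFourIdeals` (S2: `𝔰𝔭₄` is simple
and centre-free) and `HodgeLieSymplecticBlocksSemisimple` (S3: block data; an ideal of `𝔤 = Lie Hg ⊗ ℂ` kills a block or restricts onto its
`𝔰𝔭`; `𝔤` is semisimple).

SETTING as in S1: `H` effective polarized of weight `1`, `End_Hdg` self-adjoint for `ψ`, `σ_i` REAL characters with FOUR-dimensional blocks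
`T_i = H.eigenBlock (σ i)` forming an internal direct sum `V_ℂ = ⊕_i T_i`; `c_i` = restriction to `T_i`.

* **`SymplecticBlocks.exists_mem_hodgeLieC_supported`** — THE GOURSAT STEP: for every `i` and every `ψ_ℂ|_{T_i}`-skew `g` on `T_i` there is
  `Y ∈ Lie Hg ⊗ ℂ` with `Y|_{T_i} = g` and `Y|_{T_j} = 0` for all `j ≠ i`.  Proof (Moonen–Zarhin (3.1) and Lemma (3.4) for the rigid factor
  `𝔰𝔭(T_i)`, Hazama's Goursat argument over the places): in the semisimple Lie algebra `𝔏` (carrier `𝔤`) the ideal `M = ker c_i` has a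
  complementary ideal `N` (Boolean algebra of ideals), and `c_i : N ≅ 𝔰𝔭(T_i)`.  If `N` moved another block `T_j`, then `c_j(N) = 𝔰𝔭(T_j)`,
  `c_j(M) = 0` and `c_j` is injective on `N` (S2/S3), so `ρ = c_j ∘ (c_i|_N)⁻¹` is a bracket-preserving injection `𝔰𝔭(T_i) → End(T_j)`
  intertwining `ad Θ|_{T_i}` with `ad Θ|_{T_j}`; the tree's `SymplecticWitness.exists_equivariant_ne_zero` (the standard representation is the
  only length-one representation of `𝔰𝔭`) yields a non-zero `ρ`-equivariant `F : T_i → T_j`, whose extension by zero commutes with `𝔤` —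
  impossible between distinct eigenblocks (`eq_zero_of_forall_commute_hodgeLieC_of_mapsTo_eigenBlock`).  Hence `N` is supported on `T_i`.
* on the way: `SymplecticBlocks.exists_complement_ideal` (the ideal complementary to `ker c_i`, with unique representatives on `T_i`)
  and `SymplecticBlocks.eq_zero_of_equivariant` (no non-zero `T_i → T_j`, `j ≠ i`, intertwining the block restrictions of `Lie Hg ⊗ ℂ`).
  Summing supported lifts then gives `Lie Hg ⊗ ℂ = ⊕_i 𝔰𝔭(T_i, ψ_ℂ|_{T_i})` and `dim Lie Hg = 10 · #ι` («`Hg = R_{F/ℚ} Sp_{4,F}`» for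
  `H = H¹(B)`, `End⁰B = F` totally real with `dim B = 2[F:ℚ]`) — drawn downstream (`Summits/HodgeConjecture/CorCM/MumfordTateRankTypeOneRelDimTwo`).

## References

* [MoonenZarhin1995Duke] B. Moonen, Yu. G. Zarhin, Duke Math. J. 77 (1995) 553–581 (Type I(2): `Hg = R_{F/ℚ} Sp_F(V, ψ)`).
  [cite: MoonenZarhin1995Duke, Type I(2)]
* [MoonenZarhin1999LowDim] B. Moonen, Yu. G. Zarhin, Math. Ann. 315 (1999), §3 (3.1), Lemma (3.3), Lemma (3.4).
  [cite: MoonenZarhin1999LowDim, §3 (3.1) and Lemma (3.4)]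
* [Hazama1983] F. Hazama, Tôhoku Math. J. 35 (1983), §3 pp. 305–306 (Goursat over the places). [cite: Hazama1983, §3 (pp. 305–306)]
* [Humphreys1972] J. E. Humphreys, GTM 9, §5.2 (semisimple = sum of simple ideals). [cite: Humphreys1972, §5.2]
-/

noncomputable section

open scoped TensorProduct

namespace Literature.AlgebraicGeometry.Motives

namespace HodgeStructure

universe u

variable {V : Type u} [AddCommGroup V] [Module ℚ V] [Module.Finite ℚ V] [HodgeTensorFacts.{u, u}] {n : ℤ}
variable {ι : Type*} [DecidableEq ι]

/-! ### §1 The complementary ideal of the kernel of a block restriction -/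

/-- **The complementary ideal `N` of `M_i = ker c_i` in the semisimple Lie algebra `Lie Hg ⊗ ℂ`**, as a subspace of `End(V_ℂ)`:
`N ⊆ 𝔤` is an ideal, every element of `𝔤` agrees on `T_i` with a unique element of `N`, and `[M_i, N] = 0` (Boolean algebra of
ideals of a semisimple Lie algebra, Mathlib; `isSemisimple_of_eq_hodgeLieC`). [cite: Humphreys1972, §5.2]
[cite: MoonenZarhin1999LowDim, §3 (3.1) and Lemma (3.4)] -/
theorem SymplecticBlocks.exists_complement_ideal (H : HodgeStructure V n) (hn : n = 1) (heff : H.IsEffective)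
    (ψ : H.Polarization)
    (hself : ∀ a : H.endAlg, LinearMap.IsAdjointPair ψ.form ψ.form (a : Module.End ℚ V) (a : Module.End ℚ V))
    (σ : ι → (H.endAlg →+* ℂ)) (hreal : ∀ i, (starRingEnd ℂ).comp (σ i) = σ i)
    (hint : DirectSum.IsInternal fun i => H.eigenBlock (σ i)) (h4 : ∀ i, Module.finrank ℂ (H.eigenBlock (σ i)) = 4) (i : ι) :
    ∃ N : Submodule ℂ (Module.End ℂ (ℂ ⊗[ℚ] V)), N ≤ H.hodgeLieC ∧
      (∀ W ∈ H.hodgeLieC, ∀ Y ∈ N, W * Y - Y * W ∈ N) ∧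
      (∀ W ∈ H.hodgeLieC, ∃ Y ∈ N, ∀ x ∈ H.eigenBlock (σ i), W x = Y x) ∧
      (∀ Y ∈ N, (∀ x ∈ H.eigenBlock (σ i), Y x = 0) → Y = 0) ∧
      (∀ m ∈ H.hodgeLieC, (∀ x ∈ H.eigenBlock (σ i), m x = 0) → ∀ Y ∈ N, m * Y - Y * m = 0) := by
  classical
  letI : LieRing (Module.End ℂ (ℂ ⊗[ℚ] V)) := LieRing.ofAssociativeRing
  subst hn
  obtain ⟨𝔏, h𝔏⟩ := exists_lieSubalgebra_eq_hodgeLieC H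
  haveI := SymplecticBlocks.isSemisimple_of_eq_hodgeLieC H rfl heff ψ hself σ hreal hint h4 𝔏 h𝔏
  have hmem : ∀ Y : Module.End ℂ (ℂ ⊗[ℚ] V), Y ∈ H.hodgeLieC ↔ Y ∈ 𝔏 := fun Y => by
    rw [← LieSubalgebra.mem_toSubmodule, h𝔏]
  have hYT : ∀ Y ∈ H.hodgeLieC, ∀ x ∈ H.eigenBlock (σ i), Y x ∈ H.eigenBlock (σ i) :=
    fun Y hY x hx => H.apply_mem_eigenBlock_of_mem_hodgeLieC hY hx
  have hbr : ∀ W Y : 𝔏, ((⁅W, Y⁆ : 𝔏) : Module.End ℂ (ℂ ⊗[ℚ] V)) =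
      (W : Module.End ℂ (ℂ ⊗[ℚ] V)) * (Y : Module.End ℂ (ℂ ⊗[ℚ] V)) -
        (Y : Module.End ℂ (ℂ ⊗[ℚ] V)) * (W : Module.End ℂ (ℂ ⊗[ℚ] V)) :=
    fun W Y => by rw [LieSubalgebra.coe_bracket, LieRing.of_associative_ring_bracket]
  -- the ideal `M` of elements killing `T_i`, and a complementary ideal `N`
  obtain ⟨M, hmemM⟩ : ∃ M : LieIdeal ℂ 𝔏,
      ∀ Y : 𝔏, Y ∈ M ↔ ∀ x ∈ H.eigenBlock (σ i), (Y : Module.End ℂ (ℂ ⊗[ℚ] V)) x = 0 :=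
    ⟨{ toSubmodule :=
          { carrier := {Y : 𝔏 | ∀ x ∈ H.eigenBlock (σ i), (Y : Module.End ℂ (ℂ ⊗[ℚ] V)) x = 0}
            zero_mem' := fun x _ => by simp
            add_mem' := fun {Y Y'} hY hY' x hx => by
              rw [AddMemClass.coe_add, LinearMap.add_apply, hY x hx, hY' x hx, add_zero]
            smul_mem' := fun c {Y} hY x hx => by
              rw [SetLike.val_smul, LinearMap.smul_apply, hY x hx, smul_zero] },
        lie_mem := fun {W Y} hY x hx => by
          have hY' : ∀ x ∈ H.eigenBlock (σ i), (Y : Module.End ℂ (ℂ ⊗[ℚ] V)) x = 0 := hY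
          rw [hbr, LinearMap.sub_apply, Module.End.mul_apply, Module.End.mul_apply, hY' x hx, map_zero,
            hY' _ (hYT _ ((hmem _).2 W.2) x hx), sub_zero] }, fun Y => Iff.rfl⟩
  obtain ⟨N, hc⟩ : ∃ N : LieIdeal ℂ 𝔏, IsCompl M N := ⟨Mᶜ, isCompl_compl⟩
  have hinf : ∀ Y : 𝔏, Y ∈ M → Y ∈ N → Y = 0 := fun Y h1 h2 => by
    have h : Y ∈ M ⊓ N := (LieSubmodule.mem_inf M N Y).2 ⟨h1, h2⟩
    rwa [hc.inf_eq_bot, LieSubmodule.mem_bot] at h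
  have hsup : ∀ Y : 𝔏, ∃ m ∈ M, ∃ nn ∈ N, m + nn = Y := fun Y => by
    have h : Y ∈ M ⊔ N := by rw [hc.sup_eq_top]; exact LieSubmodule.mem_top Y
    exact (LieSubmodule.mem_sup M N Y).1 h
  refine ⟨N.toSubmodule.map 𝔏.toSubmodule.subtype, ?_, ?_, ?_, ?_, ?_⟩
  · rintro _ ⟨y, -, rfl⟩
    exact (hmem _).2 y.2
  · rintro W hW _ ⟨y, hy, rfl⟩
    exact ⟨⁅(⟨W, (hmem W).1 hW⟩ : 𝔏), y⁆, N.lie_mem hy, hbr _ _⟩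
  · intro W hW
    obtain ⟨m, hm, nn, hnn, hsum⟩ := hsup ⟨W, (hmem W).1 hW⟩
    refine ⟨nn, ⟨nn, hnn, rfl⟩, fun x hx => ?_⟩
    have h := congrArg (fun Y : 𝔏 => (Y : Module.End ℂ (ℂ ⊗[ℚ] V)) x) hsum
    simp only [AddMemClass.coe_add, LinearMap.add_apply] at h
    rw [(hmemM m).1 hm x hx, zero_add] at h
    exact h.symm
  · rintro _ ⟨y, hy, rfl⟩ h0
    have h := hinf y ((hmemM y).2 h0) hy
    rw [h]
    exact ZeroMemClass.coe_zero 𝔏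
  · rintro m hm hm0 _ ⟨y, hy, rfl⟩
    have hmM : (⟨m, (hmem m).1 hm⟩ : 𝔏) ∈ M := (hmemM _).2 hm0
    have h0 : ⁅(⟨m, (hmem m).1 hm⟩ : 𝔏), y⁆ = 0 :=
      hinf _ (by rw [← lie_skew]; exact M.neg_mem (M.lie_mem hmM)) (N.lie_mem hy)
    have h1 := congrArg (fun Y : 𝔏 => (Y : Module.End ℂ (ℂ ⊗[ℚ] V))) h0
    simp only [hbr, ZeroMemClass.coe_zero] at h1
    exact h1

/-! ### §2 No non-zero `𝔤`-equivariant map between distinct blocks -/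

/-- **A `ℂ`-linear `F : T_i → T_j` (`i ≠ j`) intertwining the restrictions of every element of `Lie Hg ⊗ ℂ` vanishes**: its extension
by zero to `V_ℂ = T_i ⊕ ⨆_{k ≠ i} T_k` commutes with `Lie Hg ⊗ ℂ`, hence lies in `End_Hdg ⊗ ℂ`, which carries no block into another
(`eq_zero_of_forall_commute_hodgeLieC_of_mapsTo_eigenBlock`; Moonen–Zarhin Lemma (3.4): the equivariant part of `Hom` consists of Hodge
classes). [cite: MoonenZarhin1999LowDim, §3 (3.1) and Lemma (3.4)] [cite: Hazama1983, §3 (pp. 305–306)] -/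
theorem SymplecticBlocks.eq_zero_of_equivariant (H : HodgeStructure V n) (σ : ι → (H.endAlg →+* ℂ))
    (hint : DirectSum.IsInternal fun i => H.eigenBlock (σ i)) (h4 : ∀ i, Module.finrank ℂ (H.eigenBlock (σ i)) = 4) {i j : ι}
    (hji : j ≠ i) (F : ↥(H.eigenBlock (σ i)) →ₗ[ℂ] ↥(H.eigenBlock (σ j)))
    (hF : ∀ (W : Module.End ℂ (ℂ ⊗[ℚ] V)) (hW : W ∈ H.hodgeLieC) (x : H.eigenBlock (σ i)),
      ((F ⟨W x, H.apply_mem_eigenBlock_of_mem_hodgeLieC hW x.2⟩ : H.eigenBlock (σ j)) : ℂ ⊗[ℚ] V) =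
        W ((F x : H.eigenBlock (σ j)) : ℂ ⊗[ℚ] V)) : F = 0 := by
  classical
  have hYT : ∀ Y ∈ H.hodgeLieC, ∀ k, ∀ x ∈ H.eigenBlock (σ k), Y x ∈ H.eigenBlock (σ k) :=
    fun Y hY k x hx => H.apply_mem_eigenBlock_of_mem_hodgeLieC hY hx
  have hdisj : Disjoint (H.eigenBlock (σ i)) (⨆ (k) (_ : k ≠ i), H.eigenBlock (σ k)) := iSupIndep_def.1 hint.submodule_iSupIndep i
  have hcod : H.eigenBlock (σ i) ⊔ (⨆ (k) (_ : k ≠ i), H.eigenBlock (σ k)) = ⊤ := by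
    rw [← hint.submodule_iSup_eq_top, iSup_split_single (fun k => H.eigenBlock (σ k)) i]
  have hcT : IsCompl (H.eigenBlock (σ i)) (⨆ (k) (_ : k ≠ i), H.eigenBlock (σ k)) := ⟨hdisj, codisjoint_iff.2 hcod⟩
  obtain ⟨Zx, hZx_left, hZx_right⟩ : ∃ Zx : Module.End ℂ (ℂ ⊗[ℚ] V),
      (∀ x (hx : x ∈ H.eigenBlock (σ i)), Zx x = F ⟨x, hx⟩) ∧ ∀ x ∈ (⨆ (k) (_ : k ≠ i), H.eigenBlock (σ k)), Zx x = 0 :=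
    ⟨(H.eigenBlock (σ j)).subtype ∘ₗ F ∘ₗ (H.eigenBlock (σ i)).projectionOnto _ hcT,
      fun x hx => by
        rw [LinearMap.comp_apply, LinearMap.comp_apply, Submodule.projectionOnto_apply_of_mem_left hcT hx, Submodule.coe_subtype],
      fun x hx => by
        rw [LinearMap.comp_apply, LinearMap.comp_apply, Submodule.projectionOnto_apply_of_mem_right hcT hx, map_zero, map_zero]⟩
  have hCstab : ∀ W ∈ H.hodgeLieC, ∀ x ∈ (⨆ (k) (_ : k ≠ i), H.eigenBlock (σ k)), W x ∈ (⨆ (k) (_ : k ≠ i), H.eigenBlock (σ k)) := by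
    intro W hW x hx
    have hle : (⨆ (k) (_ : k ≠ i), H.eigenBlock (σ k)) ≤ Submodule.comap W (⨆ (k) (_ : k ≠ i), H.eigenBlock (σ k)) := by
      refine iSup₂_le fun k hk y hy => ?_
      rw [Submodule.mem_comap]
      exact Submodule.mem_iSup_of_mem (p := fun k => ⨆ (_ : k ≠ i), H.eigenBlock (σ k)) k
        (Submodule.mem_iSup_of_mem (p := fun _ : k ≠ i => H.eigenBlock (σ k)) hk (hYT W hW k y hy))
    exact hle hx
  have hcomm : ∀ W ∈ H.hodgeLieC, Zx * W = W * Zx := by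
    intro W hW
    refine LinearMap.ext fun v => ?_
    obtain ⟨a, ha, c, hcC, rfl⟩ := Submodule.mem_sup.1 (show v ∈ H.eigenBlock (σ i) ⊔ (⨆ (k) (_ : k ≠ i), H.eigenBlock (σ k)) by
      rw [hcod]; exact Submodule.mem_top)
    rw [Module.End.mul_apply, Module.End.mul_apply, map_add, map_add, map_add, map_add, hZx_right c hcC, map_zero, add_zero,
      hZx_right _ (hCstab W hW c hcC), add_zero, hZx_left a ha, hZx_left _ (hYT W hW i a ha)]
    exact hF W hW ⟨a, ha⟩
  have hσ : σ i ≠ σ j := by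
    intro h
    have hd : Disjoint (H.eigenBlock (σ i)) (H.eigenBlock (σ j)) := hint.submodule_iSupIndep.pairwiseDisjoint (Ne.symm hji)
    rw [← h, disjoint_self] at hd
    have h4i := h4 i
    rw [hd, finrank_bot] at h4i
    exact absurd h4i (by norm_num)
  refine LinearMap.ext fun x => Subtype.ext ?_
  rw [LinearMap.zero_apply, Submodule.coe_zero, ← hZx_left x.1 x.2]
  exact eq_zero_of_forall_commute_hodgeLieC_of_mapsTo_eigenBlock H hσ hcomm
    (fun y hy => by rw [hZx_left y hy]; exact (F ⟨y, hy⟩).2) x.2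

/-! ### §3 The Goursat step: supported lifts -/

/-- **The Goursat step (Moonen–Zarhin (3.1)/(3.4) for a rigid symplectic factor).**  In the four-dimensional real-block situation, for every
block `T_i` and every `ψ_ℂ|_{T_i}`-skew `ℂ`-linear `g : T_i → T_i` there is `Y ∈ Lie Hg(H) ⊗ ℂ` with `Y|_{T_i} = g` and `Y|_{T_j} = 0` for all
`j ≠ i`.  See the module docstring for the proof. [cite: MoonenZarhin1999LowDim, §3 (3.1) and Lemma (3.4)] [cite: MoonenZarhin1995Duke, Type I(2)]
[cite: Hazama1983, §3 (pp. 305–306)] -/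
theorem SymplecticBlocks.exists_mem_hodgeLieC_supported (H : HodgeStructure V n) (hn : n = 1) (heff : H.IsEffective)
    (ψ : H.Polarization)
    (hself : ∀ a : H.endAlg, LinearMap.IsAdjointPair ψ.form ψ.form (a : Module.End ℚ V) (a : Module.End ℚ V))
    (σ : ι → (H.endAlg →+* ℂ)) (hreal : ∀ i, (starRingEnd ℂ).comp (σ i) = σ i)
    (hint : DirectSum.IsInternal fun i => H.eigenBlock (σ i)) (h4 : ∀ i, Module.finrank ℂ (H.eigenBlock (σ i)) = 4) (i : ι) :
    ∀ g : Module.End ℂ ↥(H.eigenBlock (σ i)),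
      (∀ x y : H.eigenBlock (σ i), ψ.form.baseChange ℂ ((g x : H.eigenBlock (σ i)) : ℂ ⊗[ℚ] V) y +
        ψ.form.baseChange ℂ (x : ℂ ⊗[ℚ] V) ((g y : H.eigenBlock (σ i)) : ℂ ⊗[ℚ] V) = 0) →
      ∃ Y ∈ H.hodgeLieC, (∀ x : H.eigenBlock (σ i), ((g x : H.eigenBlock (σ i)) : ℂ ⊗[ℚ] V) = Y x) ∧
        ∀ j, j ≠ i → ∀ x ∈ H.eigenBlock (σ j), Y x = 0 := by
  classical
  subst hn
  have hYT : ∀ Y ∈ H.hodgeLieC, ∀ k, ∀ x ∈ H.eigenBlock (σ k), Y x ∈ H.eigenBlock (σ k) :=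
    fun Y hY k x hx => H.apply_mem_eigenBlock_of_mem_hodgeLieC hY hx
  obtain ⟨N', hN'le, hN'ideal, hN'dec, hN'uniq, hMN⟩ := SymplecticBlocks.exists_complement_ideal H rfl heff ψ hself σ hreal hint h4 i
  -- lifting a skew operator on `T_i` into `N'`
  have hliftN : ∀ g' : Module.End ℂ ↥(H.eigenBlock (σ i)),
      (∀ x y : H.eigenBlock (σ i), ψ.form.baseChange ℂ ((g' x : H.eigenBlock (σ i)) : ℂ ⊗[ℚ] V) y +
        ψ.form.baseChange ℂ (x : ℂ ⊗[ℚ] V) ((g' y : H.eigenBlock (σ i)) : ℂ ⊗[ℚ] V) = 0) →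
      ∃ Y ∈ N', ∀ x : H.eigenBlock (σ i), ((g' x : H.eigenBlock (σ i)) : ℂ ⊗[ℚ] V) = Y x := by
    intro g' hg'
    obtain ⟨W, hW, hWg⟩ := SymplecticBlocks.exists_mem_hodgeLieC_restrict_eq H rfl heff ψ hself σ hreal hint h4 i g' hg'
    obtain ⟨Y, hY, hWY⟩ := hN'dec W hW
    exact ⟨Y, hY, fun x => by rw [hWg x, hWY _ x.2]⟩
  have huniqN : ∀ Y Y', Y ∈ N' → Y' ∈ N' → (∀ x ∈ H.eigenBlock (σ i), Y x = Y' x) → Y = Y' :=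
    fun Y Y' hY hY' h => sub_eq_zero.1 (hN'uniq _ (N'.sub_mem hY hY') fun x hx => by rw [LinearMap.sub_apply, h x hx, sub_self])
  intro g hg
  -- either `N'` is supported on `T_i` (done), or it moves some other block `T_j` (impossible)
  by_cases hsupp : ∀ j, j ≠ i → ∀ Y ∈ N', ∀ x ∈ H.eigenBlock (σ j), Y x = 0
  · obtain ⟨Y, hY, hg'⟩ := hliftN g hg
    exact ⟨Y, hN'le hY, hg', fun j hj x hx => hsupp j hj Y hY x hx⟩
  exfalso
  push Not at hsupp
  obtain ⟨j, hji, Y₀, hY₀, x₀, hx₀, hY₀x₀⟩ := hsupp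
  -- `N'` restricts onto `𝔰𝔭(T_j)`, `M` kills `T_j`, and `c_j` is injective on `N'`
  have hNonto := (SymplecticBlocks.restrict_ideal_dichotomy H rfl heff ψ hself σ hreal hint h4 N' hN'le hN'ideal j).resolve_left
    (fun h => hY₀x₀ (h Y₀ hY₀ x₀ hx₀))
  have hMj : ∀ m ∈ H.hodgeLieC, (∀ x ∈ H.eigenBlock (σ i), m x = 0) → ∀ x ∈ H.eigenBlock (σ j), m x = 0 :=
    fun m hm hm0 x hx => SymplecticBlocks.apply_eq_zero_of_forall_commute H rfl heff ψ hself σ hreal hint h4 j N' hNonto hm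
      (fun Y hY y _ => by
        have h := hMN m hm hm0 Y hY
        rw [← neg_sub, h, neg_zero, LinearMap.zero_apply]) hx
  have hinjN : ∀ Y ∈ N', (∀ x ∈ H.eigenBlock (σ j), Y x = 0) → Y = 0 := by
    -- the ideal `K = N' ∩ ker c_j`
    obtain ⟨K, hmemK⟩ : ∃ K : Submodule ℂ (Module.End ℂ (ℂ ⊗[ℚ] V)), ∀ Y, Y ∈ K ↔ Y ∈ N' ∧ ∀ x ∈ H.eigenBlock (σ j), Y x = 0 :=
      ⟨{ carrier := {Y | Y ∈ N' ∧ ∀ x ∈ H.eigenBlock (σ j), Y x = 0}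
         zero_mem' := ⟨N'.zero_mem, fun x _ => by simp⟩
         add_mem' := fun {Y Y'} hY hY' => ⟨N'.add_mem hY.1 hY'.1, fun x hx => by
           rw [LinearMap.add_apply, hY.2 x hx, hY'.2 x hx, add_zero]⟩
         smul_mem' := fun c {Y} hY => ⟨N'.smul_mem c hY.1, fun x hx => by rw [LinearMap.smul_apply, hY.2 x hx, smul_zero]⟩ },
        fun Y => Iff.rfl⟩
    have hKle : K ≤ H.hodgeLieC := fun Y hY => hN'le ((hmemK Y).1 hY).1
    have hKideal : ∀ W ∈ H.hodgeLieC, ∀ Y ∈ K, W * Y - Y * W ∈ K := fun W hW Y hY =>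
      (hmemK _).2 ⟨hN'ideal W hW Y ((hmemK Y).1 hY).1, fun x hx => by
        rw [LinearMap.sub_apply, Module.End.mul_apply, Module.End.mul_apply, ((hmemK Y).1 hY).2 x hx, map_zero,
          ((hmemK Y).1 hY).2 _ (hYT W hW j x hx), sub_zero]⟩
    rcases SymplecticBlocks.restrict_ideal_dichotomy H rfl heff ψ hself σ hreal hint h4 K hKle hKideal i with hK | hK
    · exact fun Y hY hYj => hN'uniq Y hY (hK Y ((hmemK Y).2 ⟨hY, hYj⟩))
    · exfalso
      apply hY₀x₀
      have hskew : ∀ x y : H.eigenBlock (σ i),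
          ψ.form.baseChange ℂ (((Y₀.restrict fun x hx => hYT _ (hN'le hY₀) i x hx) x : H.eigenBlock (σ i)) : ℂ ⊗[ℚ] V) y +
            ψ.form.baseChange ℂ (x : ℂ ⊗[ℚ] V) (((Y₀.restrict fun x hx => hYT _ (hN'le hY₀) i x hx) y : H.eigenBlock (σ i)) :
              ℂ ⊗[ℚ] V) = 0 := fun x y => by
        rw [LinearMap.coe_restrict_apply, LinearMap.coe_restrict_apply, formBaseChange_skew_of_mem_hodgeLieC ψ (hN'le hY₀),
          neg_add_cancel]
      obtain ⟨Yk, hYk, hYk'⟩ := hK _ hskew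
      have hyk : Y₀ = Yk := huniqN Y₀ Yk hY₀ ((hmemK Yk).1 hYk).1 fun x hx => by
        have h := hYk' ⟨x, hx⟩
        rwa [LinearMap.coe_restrict_apply] at h
      rw [hyk]
      exact ((hmemK Yk).1 hYk).2 x₀ hx₀
  -- block data on `T_i` and `T_j`
  obtain ⟨Θ, hΘ⟩ := exists_hodgeTheta H
  have hΘC : Θ ∈ H.hodgeLieC := H.mem_hodgeLieC_of_forall_piece hΘ
  obtain ⟨hωnd, hωalt, TΘ, P, Q, hTΘ, hTT, hTskew, hP, hQ, hPmem, hQmem, hP2, hQ2⟩ :=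
    SymplecticBlocks.exists_blockData H rfl heff ψ hself σ hreal hint h4 hΘ i
  obtain ⟨-, -, TΘj, -, -, hTΘj, hTTj, -⟩ := SymplecticBlocks.exists_blockData H rfl heff ψ hself σ hreal hint h4 hΘ j
  set ω : LinearMap.BilinForm ℂ ↥(H.eigenBlock (σ i)) :=
    (ψ.form.baseChange ℂ).compl₁₂ (H.eigenBlock (σ i)).subtype (H.eigenBlock (σ i)).subtype with hω
  have hω_apply : ∀ x y : H.eigenBlock (σ i), ω x y = ψ.form.baseChange ℂ (x : ℂ ⊗[ℚ] V) y := fun x y => rfl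
  clear_value ω
  have hP0 : P ≠ ⊥ := by
    intro h
    rw [h, finrank_bot] at hP2
    exact absurd hP2 (by norm_num)
  -- the skew operators on `T_i`
  obtain ⟨𝔰, hmem𝔰⟩ : ∃ 𝔰 : Submodule ℂ (Module.End ℂ ↥(H.eigenBlock (σ i))),
      ∀ Z, Z ∈ 𝔰 ↔ ∀ x y : H.eigenBlock (σ i), ω (Z x) y + ω x (Z y) = 0 :=
    ⟨{ carrier := {Z | ∀ x y : H.eigenBlock (σ i), ω (Z x) y + ω x (Z y) = 0}
       zero_mem' := fun x y => by simp
       add_mem' := by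
         intro Z Z' hZ hZ' x y
         simp only [LinearMap.add_apply, map_add]
         have h1 := hZ x y
         have h2 := hZ' x y
         linear_combination h1 + h2
       smul_mem' := by
         intro c Z hZ x y
         simp only [LinearMap.smul_apply, map_smul, smul_eq_mul]
         have h1 := hZ x y
         linear_combination c * h1 }, fun Z => Iff.rfl⟩
  -- the lift `𝔰 → N'` and the transport `ρ : End(T_i) → End(T_j)`
  have hlift : ∀ Z : 𝔰, ∃ Y, Y ∈ N' ∧
      ∀ x : H.eigenBlock (σ i), ((((Z : Module.End ℂ ↥(H.eigenBlock (σ i))) x) : H.eigenBlock (σ i)) : ℂ ⊗[ℚ] V) = Y x :=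
    fun Z => hliftN Z fun x y => by rw [← hω_apply, ← hω_apply]; exact (hmem𝔰 _).1 Z.2 x y
  choose lift hliftN_mem hlift_eq using hlift
  have hlift_eq' : ∀ (Z : Module.End ℂ ↥(H.eigenBlock (σ i))) (hZ : Z ∈ 𝔰) (x : H.eigenBlock (σ i)),
      ((Z x : H.eigenBlock (σ i)) : ℂ ⊗[ℚ] V) = lift ⟨Z, hZ⟩ x := fun Z hZ x => hlift_eq ⟨Z, hZ⟩ x
  have hlift_unique : ∀ (Z : 𝔰) (Y : Module.End ℂ (ℂ ⊗[ℚ] V)), Y ∈ N' →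
      (∀ x : H.eigenBlock (σ i), ((((Z : Module.End ℂ ↥(H.eigenBlock (σ i))) x) : H.eigenBlock (σ i)) : ℂ ⊗[ℚ] V) = Y x) →
      lift Z = Y :=
    fun Z Y hY h => huniqN _ _ (hliftN_mem Z) hY fun x hx => by rw [← hlift_eq Z ⟨x, hx⟩, h ⟨x, hx⟩]
  have hlift_add : ∀ Z Z' : 𝔰, lift (Z + Z') = lift Z + lift Z' :=
    fun Z Z' => hlift_unique _ _ (N'.add_mem (hliftN_mem Z) (hliftN_mem Z')) fun x => by
      rw [Submodule.coe_add, LinearMap.add_apply, Submodule.coe_add, hlift_eq, hlift_eq, LinearMap.add_apply]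
  have hlift_smul : ∀ (c : ℂ) (Z : 𝔰), lift (c • Z) = c • lift Z :=
    fun c Z => hlift_unique _ _ (N'.smul_mem c (hliftN_mem Z)) fun x => by
      rw [Submodule.coe_smul, LinearMap.smul_apply, Submodule.coe_smul, hlift_eq, LinearMap.smul_apply]
  have hliftTj : ∀ Z : 𝔰, ∀ x ∈ H.eigenBlock (σ j), lift Z x ∈ H.eigenBlock (σ j) :=
    fun Z x hx => hYT _ (hN'le (hliftN_mem Z)) j x hx
  obtain ⟨ρ₀, hρ₀⟩ : ∃ ρ₀ : 𝔰 →ₗ[ℂ] Module.End ℂ ↥(H.eigenBlock (σ j)), ∀ (Z : 𝔰) (x : H.eigenBlock (σ j)),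
      ((ρ₀ Z x : H.eigenBlock (σ j)) : ℂ ⊗[ℚ] V) = lift Z x :=
    ⟨{ toFun := fun Z => (lift Z).restrict (hliftTj Z)
       map_add' := fun Z Z' => LinearMap.ext fun x => Subtype.ext (by
         simp only [LinearMap.coe_restrict_apply, LinearMap.add_apply, hlift_add, Submodule.coe_add])
       map_smul' := fun c Z => LinearMap.ext fun x => Subtype.ext (by
         simp only [LinearMap.coe_restrict_apply, LinearMap.smul_apply, hlift_smul, Submodule.coe_smul, RingHom.id_apply]) },
      fun Z x => rfl⟩
  obtain ⟨C, hC⟩ := Submodule.exists_isCompl (K := ℂ) (V := Module.End ℂ ↥(H.eigenBlock (σ i))) 𝔰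
  obtain ⟨π𝔰, hπ𝔰⟩ : ∃ π𝔰 : Module.End ℂ ↥(H.eigenBlock (σ i)) →ₗ[ℂ] ↥𝔰, ∀ Z (hZ : Z ∈ 𝔰), π𝔰 Z = ⟨Z, hZ⟩ :=
    ⟨Submodule.projectionOnto (R := ℂ) (E := Module.End ℂ ↥(H.eigenBlock (σ i))) 𝔰 C hC, fun Z hZ =>
      Submodule.projectionOnto_apply_of_mem_left hC hZ⟩
  obtain ⟨ρ, hρ⟩ : ∃ ρ : Module.End ℂ ↥(H.eigenBlock (σ i)) →ₗ[ℂ] Module.End ℂ ↥(H.eigenBlock (σ j)),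
      ∀ Z (hZ : Z ∈ 𝔰) (x : H.eigenBlock (σ j)), ((ρ Z x : H.eigenBlock (σ j)) : ℂ ⊗[ℚ] V) = lift ⟨Z, hZ⟩ x :=
    ⟨ρ₀ ∘ₗ π𝔰, fun Z hZ x => by rw [LinearMap.comp_apply, hπ𝔰 Z hZ, hρ₀]⟩
  -- `ρ` on the restriction of an element of `𝔤`: it is the `T_j`-restriction of the same element
  have hskew𝔰 : ∀ (W : Module.End ℂ (ℂ ⊗[ℚ] V)) (hW : W ∈ H.hodgeLieC), W.restrict (fun x hx => hYT W hW i x hx) ∈ 𝔰 :=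
    fun W hW => (hmem𝔰 _).2 fun x y => by
      rw [hω_apply, hω_apply, LinearMap.coe_restrict_apply, LinearMap.coe_restrict_apply, formBaseChange_skew_of_mem_hodgeLieC ψ hW,
        neg_add_cancel]
  have hρ_restrict : ∀ (W : Module.End ℂ (ℂ ⊗[ℚ] V)) (hW : W ∈ H.hodgeLieC) (x : H.eigenBlock (σ j)),
      ((ρ (W.restrict fun x hx => hYT W hW i x hx) x : H.eigenBlock (σ j)) : ℂ ⊗[ℚ] V) = W x := by
    intro W hW x
    obtain ⟨Y, hY, hWY⟩ := hN'dec W hW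
    have hl : lift ⟨_, hskew𝔰 W hW⟩ = Y := hlift_unique _ Y hY fun y => by rw [LinearMap.coe_restrict_apply, hWY _ y.2]
    have hWYj : ∀ y ∈ H.eigenBlock (σ j), (W - Y) y = 0 :=
      hMj (W - Y) (Submodule.sub_mem _ hW (hN'le hY)) fun y hy => by rw [LinearMap.sub_apply, hWY y hy, sub_self]
    have h := hWYj x x.2
    rw [LinearMap.sub_apply, sub_eq_zero] at h
    rw [hρ _ (hskew𝔰 W hW), hl, h]
  -- hypotheses of the witness theorem
  have hρbr : ∀ Z ∈ 𝔰, ∀ Z' ∈ 𝔰, ρ (Z * Z' - Z' * Z) = ρ Z * ρ Z' - ρ Z' * ρ Z := by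
    intro Z hZ Z' hZ'
    have h𝔰br : Z * Z' - Z' * Z ∈ 𝔰 := (hmem𝔰 _).2 fun x y => by
      simp only [LinearMap.sub_apply, Module.End.mul_apply, map_sub, LinearMap.sub_apply]
      have h1 := (hmem𝔰 Z).1 hZ (Z' x) y
      have h2 := (hmem𝔰 Z').1 hZ' x (Z y)
      have h3 := (hmem𝔰 Z').1 hZ' (Z x) y
      have h4 := (hmem𝔰 Z).1 hZ x (Z' y)
      linear_combination h1 - h3 + h4 - h2
    have hl : lift ⟨_, h𝔰br⟩ = lift ⟨Z, hZ⟩ * lift ⟨Z', hZ'⟩ - lift ⟨Z', hZ'⟩ * lift ⟨Z, hZ⟩ :=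
      hlift_unique _ _ (hN'ideal _ (hN'le (hliftN_mem _)) _ (hliftN_mem _)) fun x => by
        change (((Z * Z' - Z' * Z) x : H.eigenBlock (σ i)) : ℂ ⊗[ℚ] V) = _
        rw [LinearMap.sub_apply, Submodule.coe_sub, Module.End.mul_apply, Module.End.mul_apply, hlift_eq' Z hZ, hlift_eq' Z' hZ',
          hlift_eq' Z' hZ', hlift_eq' Z hZ, LinearMap.sub_apply, Module.End.mul_apply, Module.End.mul_apply]
    refine LinearMap.ext fun x => Subtype.ext ?_
    rw [hρ _ h𝔰br, hl]
    simp only [LinearMap.sub_apply, Submodule.coe_sub, Module.End.mul_apply, hρ _ hZ, hρ _ hZ']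
  have hTΘ𝔰 : TΘ ∈ 𝔰 := (hmem𝔰 _).2 hTskew
  have hρTΘ : ρ TΘ = TΘj := by
    have h := hρ_restrict Θ hΘC
    have hres : Θ.restrict (fun x hx => hYT Θ hΘC i x hx) = TΘ :=
      LinearMap.ext fun x => Subtype.ext (by rw [LinearMap.coe_restrict_apply, hTΘ])
    rw [hres] at h
    exact LinearMap.ext fun x => Subtype.ext (by rw [h, hTΘj])
  have hρΘ : ∀ Z ∈ 𝔰, ρ (TΘ * Z - Z * TΘ) = TΘj * ρ Z - ρ Z * TΘj := fun Z hZ => by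
    rw [hρbr TΘ hTΘ𝔰 Z hZ, hρTΘ]
  have hinjρ : ∀ Z ∈ 𝔰, ρ Z = 0 → Z = 0 := by
    intro Z hZ h0
    have hl0 : lift ⟨Z, hZ⟩ = 0 := hinjN _ (hliftN_mem _) fun x hx => by
      have h := congrArg (fun f : Module.End ℂ ↥(H.eigenBlock (σ j)) => ((f ⟨x, hx⟩ : H.eigenBlock (σ j)) : ℂ ⊗[ℚ] V)) h0
      simp only [LinearMap.zero_apply, Submodule.coe_zero] at h
      rw [← h, hρ _ hZ]
    refine LinearMap.ext fun x => Subtype.ext ?_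
    rw [hlift_eq' Z hZ, hl0, LinearMap.zero_apply, LinearMap.zero_apply, Submodule.coe_zero]
  -- the witness: a non-zero `ρ`-equivariant `F : T_i → T_j` — which must vanish
  obtain ⟨F, hF0, hF⟩ := SymplecticWitness.exists_equivariant_ne_zero ω hωnd hωalt hTT hTskew hP hQ hPmem hQmem hP0 𝔰 hmem𝔰 hTTj ρ
    hρbr hρΘ hinjρ
  refine hF0 (SymplecticBlocks.eq_zero_of_equivariant H σ hint h4 hji F fun W hW x => ?_)
  have h := congrArg (fun f : ↥(H.eigenBlock (σ i)) →ₗ[ℂ] ↥(H.eigenBlock (σ j)) => ((f x : H.eigenBlock (σ j)) : ℂ ⊗[ℚ] V))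
    (hF _ (hskew𝔰 W hW))
  simp only [LinearMap.comp_apply] at h
  rw [hρ_restrict W hW] at h
  exact h.symm

end HodgeStructure

end Literature.AlgebraicGeometry.Motives

end
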